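import Summits.Ventures.PercRepro.ProfilePointedContainment
import Summits.Ventures.PercRepro.ProfilePointedParallelSymmetry

/-!
# PercRepro — THE COLOOP LIMIT AT A SERIES PAIR: `Φ(M, p) = Φ(M ／ e, p) + #𝒦(M ／ e, p)`
(p10, gen 17; `proofs/P10-AVFULL.md` §25)

For a finite matroid `M` on `N = #E` elements, a point `p` and the captured family `𝒦 = capSets M p`
(`X ∈ 𝒦` iff `X` and `E ∖ X` are independent, `p ∉ X`, `p ∈ cl X`), the coloop limit is
`Φ(M, p) = Σ_{X ∈ 𝒦} (2 #X − N)`; (C1′) «Φ ≥ 0» is the cell's sharpest open pointed statement.  The PARALLEL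
pair `{p, e}` (a 2-circuit) is a theorem with equality, `Φ = 0` (ProfilePointedParallelSymmetry).  This module is the
dual case, a SERIES pair `{p, e}` (a 2-cocircuit: `E ∖ {p, e}` is a hyperplane, i.e. `rk (E ∖ {p,e}) + 1 = rk E` with
neither `p` nor `e` a coloop).  Then every circuit through `p` contains `e`, so

* every captured set contains `e` (`mem_of_mem_capSets_series`), `(X ∖ e) ∪ p` is independent and
  `((E ∖ X) ∖ p) ∪ e` is independent (the hyperplane lemmas `notMem_clF_of_series_left/right`);
* `𝒦` splits by whether `e ∈ cl (E ∖ X)`: on `𝒦₂ = {X ∈ 𝒦 : e ∈ cl (E ∖ X)}` the SAME swap as at a parallel pair,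
  `X ↦ ((E ∖ X) ∖ p) ∪ e` (`parSwap`), is an involution reversing `2 #X − N` (`parSwap_mem_capSets_series`,
  `sum_capSets_signed_series_part`: the `𝒦₂`-part of `Φ` is `0`);
* on `𝒦₁ = {X ∈ 𝒦 : e ∉ cl (E ∖ X)}` the map `X ↦ X ∖ e` is a bijection onto the captured family of the contraction
  `M ／ e` at `p` (`sum_capSets_signed_series_contract`), shifting `2 #X − N` by exactly `+1`.

THE THEOREM (`sum_capSets_signed_series`): `Φ(M, p) = Φ(M ／ e, p) + #𝒦(M ／ e, p)`; hence `Φ(M ／ e, p) ≤ Φ(M, p)`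
(a proved instance of the contraction conjecture (CM)) and (C1′) at `(M, p)` follows from (C1′) at `(M ／ e, p)`, a
matroid on `N − 1` elements (`capLimit_body_series_of_contract`).  Together with the parallel theorem, (C1′) on every
finite matroid reduces to the points `p` lying in no 2-circuit and no 2-cocircuit.  Census (gen 17,
`mining/p10/g17/series.py`): the identity holds on all 86 / 268 / 826 / 2,930 series triples `(M, p, e)` of the
catalogues `n = 5 … 8`.  Nothing here asserts (C1′), (CM) or (SYM).
-/

open scoped Matroid

namespace PercRepro.Cogirth

open Finset ThmH Skew

variable {α : Type} [DecidableEq α] {M : Matroid α} [M.Finite]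

/-! ### The hyperplane `E ∖ {p, e}` -/

/-- At a series pair, a set avoiding `p` and `e` does not span `p`. -/
theorem notMem_clF_of_series_left {p e : α} (hp : p ∈ gr M) (hpe' : p ≠ e)
    (hser : rk M (((gr M).erase p).erase e) + 1 = rk M (gr M)) (heco : rk M ((gr M).erase e) = rk M (gr M))
    {A : Finset α} (hA : A ⊆ gr M) (hpA : p ∉ A) (heA : e ∉ A) : p ∉ clF M A := by
  intro hcl
  have hAH : A ⊆ ((gr M).erase p).erase e := by
    intro x hx
    rw [mem_erase, mem_erase]
    exact ⟨fun h => heA (h ▸ hx), fun h => hpA (h ▸ hx), hA hx⟩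
  have h1 : p ∈ clF M (((gr M).erase p).erase e) := clF_mono_sub hAH hcl
  rw [mem_clF_iff_rk_insert_eq hp ((erase_subset _ _).trans (erase_subset _ _))] at h1
  have h2 : insert p (((gr M).erase p).erase e) = (gr M).erase e := by
    rw [erase_right_comm, insert_erase (mem_erase.2 ⟨hpe', hp⟩)]
  rw [h2, heco] at h1
  omega

/-- At a series pair, a set avoiding `p` and `e` does not span `e`. -/
theorem notMem_clF_of_series_right {p e : α} (he : e ∈ gr M) (hpe' : p ≠ e)
    (hser : rk M (((gr M).erase p).erase e) + 1 = rk M (gr M)) (hpco : rk M ((gr M).erase p) = rk M (gr M))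
    {A : Finset α} (hA : A ⊆ gr M) (hpA : p ∉ A) (heA : e ∉ A) : e ∉ clF M A := by
  intro hcl
  have hAH : A ⊆ ((gr M).erase p).erase e := by
    intro x hx
    rw [mem_erase, mem_erase]
    exact ⟨fun h => heA (h ▸ hx), fun h => hpA (h ▸ hx), hA hx⟩
  have h1 : e ∈ clF M (((gr M).erase p).erase e) := clF_mono_sub hAH hcl
  rw [mem_clF_iff_rk_insert_eq he ((erase_subset _ _).trans (erase_subset _ _))] at h1
  have h2 : insert e (((gr M).erase p).erase e) = (gr M).erase p :=
    insert_erase (mem_erase.2 ⟨hpe'.symm, he⟩)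
  rw [h2, hpco] at h1
  omega

/-- Every captured set contains the series partner `e` of `p`. -/
theorem mem_of_mem_capSets_series {p e : α} (hp : p ∈ gr M) (hpe' : p ≠ e)
    (hser : rk M (((gr M).erase p).erase e) + 1 = rk M (gr M)) (heco : rk M ((gr M).erase e) = rk M (gr M))
    {X : Finset α} (hX : X ∈ capSets M p) : e ∈ X := by
  obtain ⟨⟨hXb, hpX⟩, hpcl⟩ := mem_capSets.1 hX
  by_contra heX
  exact notMem_clF_of_series_left hp hpe' hser heco (mem_biIndepAll.1 hXb).1 hpX heX hpcl

/-- Adding a point outside the closure of an independent set keeps it independent (rank form). -/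
theorem rk_insert_eq_card_of_notMem_clF {z : α} (hz : z ∈ gr M) {A : Finset α} (hA : A ⊆ gr M)
    (hAr : rk M A = A.card) (hzA : z ∉ A) (hcl : z ∉ clF M A) : rk M (insert z A) = (insert z A).card := by
  rw [mem_clF_iff_rk_insert_eq hz hA] at hcl
  have h1 := rk_insert_le (M := M) z A
  have h2 := rk_mono' (M := M) (subset_insert z A)
  rw [card_insert_of_notMem hzA]
  omega

/-! ### The swap on `𝒦₂ = {X ∈ 𝒦 : e ∈ cl (E ∖ X)}` -/

/-- **THE SWAP PRESERVES `𝒦₂`** at a series pair: for `X ∈ 𝒦` with `e ∈ cl (E ∖ X)`, `parSwap X = ((E ∖ X) ∖ p) ∪ e`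
is captured and again has `e ∈ cl (E ∖ parSwap X)`. -/
theorem parSwap_mem_capSets_series {p e : α} (hp : p ∈ gr M) (he : e ∈ gr M) (hpe' : p ≠ e)
    (hser : rk M (((gr M).erase p).erase e) + 1 = rk M (gr M)) (hpco : rk M ((gr M).erase p) = rk M (gr M))
    (heco : rk M ((gr M).erase e) = rk M (gr M)) {X : Finset α} (hX : X ∈ capSets M p)
    (hcap : e ∈ clF M (gr M \ X)) :
    parSwap M p e X ∈ capSets M p ∧ e ∈ clF M (gr M \ parSwap M p e X) := by
  have heX : e ∈ X := mem_of_mem_capSets_series hp hpe' hser heco hX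
  obtain ⟨⟨hXb, hpX⟩, hpcl⟩ := mem_capSets.1 hX
  obtain ⟨hXg, hXr, hXc⟩ := mem_biIndepAll.1 hXb
  have hpZ : p ∈ gr M \ X := mem_sdiff.2 ⟨hp, hpX⟩
  set Y := (gr M \ X).erase p with hYdef
  have hYg : Y ⊆ gr M := (erase_subset _ _).trans sdiff_subset
  have heY : e ∉ Y := fun h => (mem_sdiff.1 (mem_of_mem_erase h)).2 heX
  have hpY : p ∉ Y := notMem_erase p _
  have hZ : insert p Y = gr M \ X := insert_erase hpZ
  have hYr : rk M Y = Y.card := rk_eq_card_of_subset_of_rk_eq_card (erase_subset _ _) hXc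
  have hreY : rk M (insert e Y) = (insert e Y).card :=
    rk_insert_eq_card_of_notMem_clF he hYg hYr heY (notMem_clF_of_series_right he hpe' hser hpco hYg hpY heY)
  have hcomp : gr M \ insert e Y = insert p (X.erase e) := by
    rw [sdiff_insert, hYdef, sdiff_sdiff_erase hp hXg hpX, erase_insert_of_ne hpe']
  have hXeg : X.erase e ⊆ gr M := (erase_subset _ _).trans hXg
  have hpXe : p ∉ X.erase e := fun h => hpX (mem_of_mem_erase h)
  have hXer : rk M (X.erase e) = (X.erase e).card := rk_eq_card_of_subset_of_rk_eq_card (erase_subset _ _) hXr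
  have hrpXe : rk M (insert p (X.erase e)) = (insert p (X.erase e)).card :=
    rk_insert_eq_card_of_notMem_clF hp hXeg hXer hpXe
      (notMem_clF_of_series_left hp hpe' hser heco hXeg hpXe (notMem_erase e X))
  have hcapY : rk M (insert e (insert p Y)) = rk M (insert p Y) := by
    rw [hZ]
    exact (mem_clF_iff_rk_insert_eq he sdiff_subset).1 hcap
  have hpcl' : p ∈ clF M (insert e Y) := by
    rw [mem_clF_iff_rk_insert_eq hp (insert_subset he hYg), insert_comm, hcapY, hZ, hXc, ← hZ,
      card_insert_of_notMem hpY, hreY, card_insert_of_notMem heY]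
  refine ⟨?_, ?_⟩
  · unfold parSwap
    rw [← hYdef, mem_capSets, mem_biIndepAll]
    refine ⟨⟨⟨insert_subset he hYg, hreY, ?_⟩, ?_⟩, hpcl'⟩
    · rw [hcomp]
      exact hrpXe
    · rw [mem_insert, not_or]
      exact ⟨hpe', hpY⟩
  · unfold parSwap
    rw [← hYdef, hcomp, mem_clF_iff_rk_insert_eq he (insert_subset hp hXeg), hrpXe, insert_comm,
      insert_erase heX, (mem_clF_iff_rk_insert_eq hp hXg).1 hpcl, hXr, card_insert_of_notMem hpXe,
      card_erase_of_mem heX]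
    have : 0 < X.card := card_pos.2 ⟨e, heX⟩
    omega

/-- The swap is an involution on the captured family at a series pair. -/
theorem parSwap_parSwap_series {p e : α} (hp : p ∈ gr M) (hpe' : p ≠ e)
    (hser : rk M (((gr M).erase p).erase e) + 1 = rk M (gr M)) (heco : rk M ((gr M).erase e) = rk M (gr M))
    {X : Finset α} (hX : X ∈ capSets M p) : parSwap M p e (parSwap M p e X) = X := by
  have heX : e ∈ X := mem_of_mem_capSets_series hp hpe' hser heco hX
  obtain ⟨⟨hXb, hpX⟩, -⟩ := mem_capSets.1 hX
  have hXg : X ⊆ gr M := (mem_biIndepAll.1 hXb).1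
  unfold parSwap
  rw [sdiff_insert, sdiff_sdiff_erase hp hXg hpX, erase_insert_of_ne hpe',
    erase_insert (fun h => hpX (mem_of_mem_erase h)), insert_erase heX]

/-- `#(parSwap X) + #X = N` at a series pair. -/
theorem card_parSwap_add_series {p e : α} (hp : p ∈ gr M) (hpe' : p ≠ e)
    (hser : rk M (((gr M).erase p).erase e) + 1 = rk M (gr M)) (heco : rk M ((gr M).erase e) = rk M (gr M))
    {X : Finset α} (hX : X ∈ capSets M p) : (parSwap M p e X).card + X.card = (gr M).card := by
  have heX : e ∈ X := mem_of_mem_capSets_series hp hpe' hser heco hX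
  have heY : e ∉ (gr M \ X).erase p := fun h => (mem_sdiff.1 (mem_of_mem_erase h)).2 heX
  unfold parSwap
  rw [card_insert_of_notMem heY]
  have := card_pSide_add hp hX
  omega

/-- **THE `𝒦₂`-PART OF THE COLOOP LIMIT VANISHES**: `Σ_{X ∈ 𝒦, e ∈ cl (E ∖ X)} (2 #X − N) = 0`. -/
theorem sum_capSets_signed_series_part {p e : α} (hp : p ∈ gr M) (he : e ∈ gr M) (hpe' : p ≠ e)
    (hser : rk M (((gr M).erase p).erase e) + 1 = rk M (gr M)) (hpco : rk M ((gr M).erase p) = rk M (gr M))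
    (heco : rk M ((gr M).erase e) = rk M (gr M)) :
    ∑ X ∈ (capSets M p).filter (fun X => e ∈ clF M (gr M \ X)), (2 * (X.card : ℤ) - (gr M).card) = 0 := by
  apply sum_involution (fun X _ => parSwap M p e X)
  · intro X hX
    have h := card_parSwap_add_series hp hpe' hser heco (mem_filter.1 hX).1
    have h' : ((parSwap M p e X).card : ℤ) + X.card = (gr M).card := by exact_mod_cast h
    linarith
  · intro X hX hne heq
    have h := card_parSwap_add_series hp hpe' hser heco (mem_filter.1 hX).1
    rw [heq] at h
    apply hne
    have h' : (X.card : ℤ) + X.card = (gr M).card := by exact_mod_cast h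
    linarith
  · intro X hX
    rw [mem_filter] at hX ⊢
    exact parSwap_mem_capSets_series hp he hpe' hser hpco heco hX.1 hX.2
  · intro X hX
    exact parSwap_parSwap_series hp hpe' hser heco (mem_filter.1 hX).1

/-! ### `𝒦₁ = {X ∈ 𝒦 : e ∉ cl (E ∖ X)}` is the captured family of the contraction `M ／ e` -/

/-- `gr M ∖ (X ∖ e) = E ∖ X` when `e ∈ X`… after erasing `e`: `(gr M).erase e \ X.erase e = gr M \ X`. -/
theorem gr_erase_sdiff_erase_of_mem_series {e : α} {X : Finset α} (heX : e ∈ X) :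
    (gr M).erase e \ X.erase e = gr M \ X := by
  ext z
  simp only [mem_sdiff, mem_erase, not_and]
  constructor
  · rintro ⟨⟨hze, hz⟩, h⟩
    exact ⟨hz, h hze⟩
  · rintro ⟨hz, hzX⟩
    exact ⟨⟨fun hze => hzX (hze ▸ heX), hz⟩, fun _ => hzX⟩

/-- **THE `𝒦₁`-PART IS THE CONTRACTION**: `Σ_{X ∈ 𝒦, e ∉ cl (E ∖ X)} (2 #X − N) = Φ(M ／ e, p) + #𝒦(M ／ e, p)`,
via the bijection `X ↦ X ∖ e` onto `capSets (M ／ e) p`. -/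
theorem sum_capSets_signed_series_contract {p e : α} (hp : p ∈ gr M) (heI : M.Indep ({e} : Set α))
    (hpe' : p ≠ e) (hser : rk M (((gr M).erase p).erase e) + 1 = rk M (gr M))
    (heco : rk M ((gr M).erase e) = rk M (gr M)) :
    ∑ X ∈ (capSets M p).filter (fun X => e ∉ clF M (gr M \ X)), (2 * (X.card : ℤ) - (gr M).card) =
      ∑ X' ∈ capSets (M ／ ({e} : Set α)) p, ((2 * (X'.card : ℤ) - (gr (M ／ ({e} : Set α))).card) + 1) := by
  have he : e ∈ gr M := mem_gr_of_indep heI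
  have hpe : p ∈ (gr M).erase e := mem_erase.2 ⟨hpe', hp⟩
  have hgr : (gr (M ／ ({e} : Set α))).card + 1 = (gr M).card := by
    rw [gr_contract', card_erase_add_one he]
  apply sum_nbij' (fun X => X.erase e) (fun X' => insert e X')
  · -- `X ∈ 𝒦₁ ⟹ X ∖ e ∈ 𝒦(M ／ e)`
    intro X hX
    rw [mem_filter] at hX
    obtain ⟨hXK, hcap⟩ := hX
    have heX : e ∈ X := mem_of_mem_capSets_series hp hpe' hser heco hXK
    obtain ⟨⟨hXb, hpX⟩, hpcl⟩ := mem_capSets.1 hXK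
    obtain ⟨hXg, hXr, hXc⟩ := mem_biIndepAll.1 hXb
    have hXeg : X.erase e ⊆ (gr M).erase e := erase_subset_erase e hXg
    have hpXe : p ∉ X.erase e := fun h => hpX (mem_of_mem_erase h)
    have hZg : gr M \ X ⊆ (gr M).erase e := by
      intro z hz
      rw [mem_sdiff] at hz
      exact mem_erase.2 ⟨fun h => hz.2 (h ▸ heX), hz.1⟩
    have h1 := rk_contract_add_one heI hXeg
    rw [insert_erase heX, hXr] at h1
    have h2 := rk_contract_add_one heI hZg
    have heZ : e ∉ gr M \ X := fun h => (mem_sdiff.1 h).2 heX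
    rw [rk_insert_eq_card_of_notMem_clF he sdiff_subset hXc heZ hcap, card_insert_of_notMem heZ] at h2
    have h3 := rk_contract_add_one heI (insert_subset hpe hXeg)
    rw [insert_comm, insert_erase heX, (mem_clF_iff_rk_insert_eq hp hXg).1 hpcl, hXr] at h3
    rw [mem_capSets, mem_biIndepAll, gr_contract', gr_erase_sdiff_erase_of_mem_series heX]
    refine ⟨⟨⟨hXeg, ?_, ?_⟩, hpXe⟩, ?_⟩
    · rw [card_erase_of_mem heX]
      omega
    · omega
    · rw [mem_clF_iff_rk_insert_eq (M := M ／ ({e} : Set α)) (by rw [gr_contract']; exact hpe)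
        (by rw [gr_contract']; exact hXeg)]
      omega
  · -- `X' ∈ 𝒦(M ／ e) ⟹ X' ∪ e ∈ 𝒦₁`
    intro X' hX'
    rw [mem_capSets, mem_biIndepAll, gr_contract'] at hX'
    obtain ⟨⟨⟨hX'g, hX'r, hX'c⟩, hpX'⟩, hpcl'⟩ := hX'
    have heX' : e ∉ X' := fun h => (mem_erase.1 (hX'g h)).1 rfl
    have hX'g0 : X' ⊆ gr M := fun x hx => (mem_erase.1 (hX'g hx)).2
    have hcomp : gr M \ insert e X' = (gr M).erase e \ X' := by
      rw [sdiff_insert, erase_sdiff]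
    have hZ'g : (gr M).erase e \ X' ⊆ (gr M).erase e := sdiff_subset
    have heZ' : e ∉ (gr M).erase e \ X' := fun h => (mem_erase.1 (mem_sdiff.1 h).1).1 rfl
    have h1 := rk_contract_add_one heI hX'g
    rw [hX'r] at h1
    have h2 := rk_contract_add_one heI hZ'g
    rw [hX'c] at h2
    have h3 := rk_contract_add_one heI (insert_subset hpe hX'g)
    rw [mem_clF_iff_rk_insert_eq (M := M ／ ({e} : Set α)) (by rw [gr_contract']; exact hpe)
        (by rw [gr_contract']; exact hX'g), hX'r] at hpcl'
    rw [hpcl'] at h3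
    have h4 := rk_insert_le (M := M) e ((gr M).erase e \ X')
    have h5 := rk_le_card (M := M) ((gr M).erase e \ X')
    have hZ'r : rk M ((gr M).erase e \ X') = ((gr M).erase e \ X').card := by omega
    rw [mem_filter, mem_capSets, mem_biIndepAll, hcomp]
    refine ⟨⟨⟨⟨insert_subset he hX'g0, ?_, hZ'r⟩, ?_⟩, ?_⟩, ?_⟩
    · rw [card_insert_of_notMem heX']
      omega
    · rw [mem_insert, not_or]
      exact ⟨hpe', hpX'⟩
    · rw [mem_clF_iff_rk_insert_eq hp (insert_subset he hX'g0), insert_comm]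
      omega
    · rw [mem_clF_iff_rk_insert_eq he (sdiff_subset.trans (erase_subset _ _))]
      omega
  · intro X hX
    rw [mem_filter] at hX
    exact insert_erase (mem_of_mem_capSets_series hp hpe' hser heco hX.1)
  · intro X' hX'
    rw [mem_capSets, mem_biIndepAll, gr_contract'] at hX'
    exact erase_insert (fun h => (mem_erase.1 (hX'.1.1.1 h)).1 rfl)
  · intro X hX
    rw [mem_filter] at hX
    have heX : e ∈ X := mem_of_mem_capSets_series hp hpe' hser heco hX.1
    rw [card_erase_of_mem heX]
    have h0 : 0 < X.card := card_pos.2 ⟨e, heX⟩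
    have h1 : ((X.card - 1 : ℕ) : ℤ) = (X.card : ℤ) - 1 := by
      rw [Nat.cast_sub h0]
      simp
    have h2 : ((gr (M ／ ({e} : Set α))).card : ℤ) = (gr M).card - 1 := by
      have := hgr
      omega
    rw [h1, h2]
    ring

/-! ### The theorem -/

/-- **THE COLOOP LIMIT AT A SERIES PAIR**: `Φ(M, p) = Φ(M ／ e, p) + #𝒦(M ／ e, p)`. -/
theorem sum_capSets_signed_series {p e : α} (hp : p ∈ gr M) (heI : M.Indep ({e} : Set α)) (hpe' : p ≠ e)
    (hser : rk M (((gr M).erase p).erase e) + 1 = rk M (gr M)) (hpco : rk M ((gr M).erase p) = rk M (gr M))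
    (heco : rk M ((gr M).erase e) = rk M (gr M)) :
    ∑ X ∈ capSets M p, (2 * (X.card : ℤ) - (gr M).card) =
      ∑ X' ∈ capSets (M ／ ({e} : Set α)) p, (2 * (X'.card : ℤ) - (gr (M ／ ({e} : Set α))).card) +
        (capSets (M ／ ({e} : Set α)) p).card := by
  have he : e ∈ gr M := mem_gr_of_indep heI
  rw [← sum_filter_add_sum_filter_not (capSets M p) (fun X => e ∈ clF M (gr M \ X)),
    sum_capSets_signed_series_part hp he hpe' hser hpco heco, zero_add,
    sum_capSets_signed_series_contract hp heI hpe' hser heco, sum_add_distrib, sum_const, nsmul_eq_mul,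
    mul_one]

/-- **(CM) AT A SERIES PAIR**: contraction of the series partner does not increase the coloop limit,
`Φ(M ／ e, p) ≤ Φ(M, p)`. -/
theorem sum_capSets_signed_contract_le_series {p e : α} (hp : p ∈ gr M) (heI : M.Indep ({e} : Set α))
    (hpe' : p ≠ e) (hser : rk M (((gr M).erase p).erase e) + 1 = rk M (gr M))
    (hpco : rk M ((gr M).erase p) = rk M (gr M)) (heco : rk M ((gr M).erase e) = rk M (gr M)) :
    ∑ X' ∈ capSets (M ／ ({e} : Set α)) p, (2 * (X'.card : ℤ) - (gr (M ／ ({e} : Set α))).card) ≤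
      ∑ X ∈ capSets M p, (2 * (X.card : ℤ) - (gr M).card) := by
  rw [sum_capSets_signed_series hp heI hpe' hser hpco heco]
  have : (0 : ℤ) ≤ (capSets (M ／ ({e} : Set α)) p).card := by exact_mod_cast Nat.zero_le _
  linarith

/-- The signed sum over `𝒦` is the (C1′) body: `Σ_{X ∈ 𝒦} (2 #X − N) ≥ 0 ↔ N · Σ_k κ_k ≤ 2 · Σ_k k · κ_k`. -/
theorem capLimit_body_iff_sum_nonneg (p : α) :
    ((gr M).card * ∑ k ∈ range ((gr M).card + 1), capCount M k p ≤
        2 * ∑ k ∈ range ((gr M).card + 1), k * capCount M k p) ↔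
      0 ≤ ∑ X ∈ capSets M p, (2 * (X.card : ℤ) - (gr M).card) := by
  rw [sum_capSets_eq_levels]
  have hsplit : ∑ k ∈ range ((gr M).card + 1), ((2 * (k : ℤ) - (gr M).card) * (capCount M k p : ℤ)) =
      2 * ∑ k ∈ range ((gr M).card + 1), ((k : ℤ) * (capCount M k p : ℤ)) -
        ((gr M).card : ℤ) * ∑ k ∈ range ((gr M).card + 1), (capCount M k p : ℤ) := by
    rw [mul_sum, mul_sum, ← sum_sub_distrib]
    apply sum_congr rfl
    intro k _
    ring
  rw [hsplit]
  constructor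
  · intro h
    have h' : (((gr M).card * ∑ k ∈ range ((gr M).card + 1), capCount M k p : ℕ) : ℤ) ≤
        ((2 * ∑ k ∈ range ((gr M).card + 1), k * capCount M k p : ℕ) : ℤ) := by exact_mod_cast h
    push_cast at h'
    linarith
  · intro h
    have h' : (((gr M).card * ∑ k ∈ range ((gr M).card + 1), capCount M k p : ℕ) : ℤ) ≤
        ((2 * ∑ k ∈ range ((gr M).card + 1), k * capCount M k p : ℕ) : ℤ) := by
      push_cast
      linarith
    exact_mod_cast h'

/-- **(C1′) AT A SERIES PAIR FROM (C1′) AT THE CONTRACTION**: if the body of `CapLimit` holds at `(M ／ e, p)` then it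
holds at `(M, p)`. -/
theorem capLimit_body_series_of_contract {p e : α} (hp : p ∈ gr M) (heI : M.Indep ({e} : Set α)) (hpe' : p ≠ e)
    (hser : rk M (((gr M).erase p).erase e) + 1 = rk M (gr M)) (hpco : rk M ((gr M).erase p) = rk M (gr M))
    (heco : rk M ((gr M).erase e) = rk M (gr M))
    (h : (gr (M ／ ({e} : Set α))).card * ∑ k ∈ range ((gr (M ／ ({e} : Set α))).card + 1),
        capCount (M ／ ({e} : Set α)) k p ≤
      2 * ∑ k ∈ range ((gr (M ／ ({e} : Set α))).card + 1), k * capCount (M ／ ({e} : Set α)) k p) :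
    (gr M).card * ∑ k ∈ range ((gr M).card + 1), capCount M k p ≤
      2 * ∑ k ∈ range ((gr M).card + 1), k * capCount M k p := by
  rw [capLimit_body_iff_sum_nonneg] at h ⊢
  exact h.trans (sum_capSets_signed_contract_le_series hp heI hpe' hser hpco heco)

end PercRepro.Cogirth
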